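import Literature.NumberTheory.EllipticCurves.ArtinFormalismSemistableLocalProofs
import Literature.NumberTheory.EllipticCurves.AnalyticRankOverNumberFieldAbelianProofs
import Literature.NumberTheory.EllipticCurves.HasseWeilAbelianBadReduction
import Literature.NumberTheory.EllipticCurves.RootNumberTwistProofs
import Literature.NumberTheory.EllipticCurves.Rank1Residual.Predicates
import HarnessLib

/-!
# Additive classes X3/X4, base-change-and-descend: an UNRAMIFIED base change never semistabilises an additive prime

HONEST FRAMING (cell `b2b-bsdres`, run/shared/lean/b2b/bsd-rank1-residual/, verbatim in every
file): the goal of the cell is to DELETE the COMBINATION-SHAPED residual classes of the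
Birch–Swinnerton-Dyer formula for ALL analytic-rank `≤ 1` elliptic curves over `ℚ` — "full BSD
formula for every rank `≤ 1` curve in class `C`" assembled STRICTLY from published theorems — so
that the rank-`≤ 1` remainder becomes exactly the CONSTRUCTION-SHAPED classes, which are TYPED
(missing-input `Prop`s), NOT attempted. This is not "finishing BSD". Sub-cell `additive-p2`
(classes X3/X4 at a prime of ADDITIVE reduction, the potentially GOOD ORDINARY half): research
route; no claim beyond the stated classes.

Theorems only (no definition, no named fact, nothing asserted beyond what is proved). This file is
the kernel form of the LOCATED GAP of the base-change-and-descend route for the additive classes: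
"let `E` acquire semistable reduction over a finite extension `F/ℚ`, apply a `p`-part-of-BSD theorem
over `F`, descend". Every printed `p`-part / main-conjecture input over a number field `F ≠ ℚ`
requires `p` UNRAMIFIED in `F` — X. Wan, Forum Math. Sigma 3 (2015) e18, §1.1 line 1 ("`F` a totally
real number field where `p` is unramified"), Thm. 101–103; Burungale–Castella–Skinner, IMRN 2025
§2.1 hypothesis (ur) "`p ∤ D_F`"; the anticyclotomic / Heegner inputs over an imaginary quadratic or
CM field need `p` split — whereas the theorems below show that over ANY finite Galois `F/ℚ` (indeed
`M/K`) in which the additive place is unramified the curve is STILL ADDITIVE at every place above it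
(Silverman, *AEC* VII.5.4: the reduction type does not change in an unramified extension; here
deduced from the tree's Artin-formalism lemma
`WeierstrassCurve.localPolynomialAt_baseChange_of_ramificationIdxIn_eq_one`: at an unramified place
the local Euler factor upstairs is computed from the one downstairs, and `L_v = 1` characterises
additive reduction). Consequently a field `F` as in the printed over-`F` theorems cannot carry the
route: semistable reduction above an additive `p` forces `e(w ∣ p) > 1`
(`ramificationIdxIn_ne_one_of_isSemistableAt_baseChange`). The cell's prime-indexed predicate
`Rank1Residual.Addv W p` is bridged to the place-indexed `HasAdditiveReductionAt` at the place
`(primesEquiv (R := 𝓞 ℚ)).symm ⟨p, _⟩` of `𝓞 ℚ` over `p` by `hasAdditiveReductionAt_of_addv`.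

References: J. H. Silverman, *The Arithmetic of Elliptic Curves*, 2nd ed., VII.5.4 and §C.16;
X. Wan, Forum Math. Sigma 3 (2015) e18, §1.1; A. Burungale, F. Castella, C. Skinner, IMRN 2025
(arXiv:2405.00270) §2.1 (ur).
-/

noncomputable section

open scoped Classical NumberField

open Polynomial IsDedekindDomain IsDedekindDomain.HeightOneSpectrum NumberField
  Rat.HeightOneSpectrum WeierstrassCurve Literature.NumberTheory.EllipticCurves
  Literature.NumberTheory.EllipticCurves.Rank1Residual

namespace Summit.BirchSwinnertonDyer.Rank1Residual.Additive

universe u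

section General

variable {K : Type u} [Field K] [NumberField K] (W : WeierstrassCurve K) [W.IsElliptic]
  (M : Type u) [Field M] [NumberField M] [Algebra K M] [FiniteDimensional K M] [IsGalois K M]

/-- **Additive reduction persists in an unramified Galois extension** (Silverman, *AEC* VII.5.4).
Let `E/K` be an elliptic curve over a number field, `M/K` finite Galois, `v` a finite place of `K`
unramified in `M` (`e(v) = 1`) and `w ∣ v`. If `E` has additive reduction at `v` then `E_M` has
additive reduction at `w`. Proof: `L_v(E,T) = 1`, so by the unramified Artin formalism
`L_w(E_M,T) = 1 - D_f(0,0)·T + 0^f·T² = 1` (`f ≥ 1` the residue degree), which characterises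
additive reduction. -/
theorem hasAdditiveReductionAt_baseChange_of_ramificationIdxIn_eq_one
    {v : HeightOneSpectrum (𝓞 K)} {w : HeightOneSpectrum (𝓞 M)}
    (hw : w.asIdeal.under (𝓞 K) = v.asIdeal) (he : v.asIdeal.ramificationIdxIn (𝓞 M) = 1)
    (hv : W.HasAdditiveReductionAt v) : (W.baseChange M).HasAdditiveReductionAt w := by
  have hvL : W.localPolynomialAt v = 1 - C (0 : ℤ) * X + C (0 : ℤ) * X ^ 2 := by
    rw [localPolynomialAt_of_hasAdditiveReductionAt hv]
    simp
  have hf : 0 < w.asIdeal.inertiaDeg (𝓞 K) := by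
    haveI : w.asIdeal.IsMaximal := w.isMaximal
    haveI : w.asIdeal.LiesOver v.asIdeal := ⟨hw.symm⟩
    exact Ideal.inertiaDeg_pos w.asIdeal (𝓞 K)
  have hD : ∀ n : ℕ, 0 < n → (dickson 1 (0 : ℤ) n).eval 0 = 0 := by
    intro n hn
    match n, hn with
    | 1, _ => simp [dickson_one]
    | n + 2, _ => simp [dickson_add_two]
  refine (W.baseChange M).hasAdditiveReductionAt_of_localPolynomialAt_eq_one ?_
  rw [W.localPolynomialAt_baseChange_of_ramificationIdxIn_eq_one M hw he hvL, zero_pow hf.ne',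
    hD _ hf]
  simp

/-- **An unramified Galois base change does not make an additive place semistable**: with `v`
unramified in `M/K` and `w ∣ v`, additive reduction of `E` at `v` excludes good-or-multiplicative
reduction of `E_M` at `w`. -/
theorem not_isSemistableAt_baseChange_of_ramificationIdxIn_eq_one
    {v : HeightOneSpectrum (𝓞 K)} {w : HeightOneSpectrum (𝓞 M)}
    (hw : w.asIdeal.under (𝓞 K) = v.asIdeal) (he : v.asIdeal.ramificationIdxIn (𝓞 M) = 1)
    (hv : W.HasAdditiveReductionAt v) : ¬ (W.baseChange M).IsSemistableAt w := by
  rw [isSemistableAt_iff_not_hasAdditiveReductionAt, not_not]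
  exact hasAdditiveReductionAt_baseChange_of_ramificationIdxIn_eq_one W M hw he hv

/-- **Semistabilising an additive place forces ramification** (the located gap of the
base-change-and-descend route, kernel form): if `E` is additive at `v` and `E_M` is semistable (good
or multiplicative) at some `w ∣ v`, then `v` is ramified in the Galois extension `M/K`:
`e(v) ≠ 1`. -/
theorem ramificationIdxIn_ne_one_of_isSemistableAt_baseChange
    {v : HeightOneSpectrum (𝓞 K)} {w : HeightOneSpectrum (𝓞 M)}
    (hw : w.asIdeal.under (𝓞 K) = v.asIdeal) (hv : W.HasAdditiveReductionAt v)
    (hss : (W.baseChange M).IsSemistableAt w) : v.asIdeal.ramificationIdxIn (𝓞 M) ≠ 1 :=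
  fun he ↦ not_isSemistableAt_baseChange_of_ramificationIdxIn_eq_one W M hw he hv hss

end General

/-! ### Over `ℚ`: the cell's predicate `Addv W p` -/

section Rat

variable (W : WeierstrassCurve ℚ) [W.IsElliptic] (p : ℕ) [hp : Fact p.Prime]

/-- `primesEquiv` of the place of `𝓞 ℚ` over `p` (`(primesEquiv (R := 𝓞 ℚ)).symm ⟨p, _⟩`,
Mathlib's `Rat.HeightOneSpectrum.primesEquiv`) is `p`. -/
theorem primesEquiv_symm_apply_coe :
    (primesEquiv ((primesEquiv (R := 𝓞 ℚ)).symm ⟨p, hp.out⟩) : ℕ) = p := by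
  simp

/-- **The cell's `add(p)` is additive reduction at the place over `p`.** `Rank1Residual.Addv W p`
("neither good nor multiplicative `ℤ_[p]`-minimal model", bsdN/HYPOTHESES.md) implies
`W.HasAdditiveReductionAt` at the place of `𝓞 ℚ` over `p` (Mathlib's local trichotomy over `ℤ_[p]`,
then the tree's bridge `hasAdditiveReduction_padic_iff_hasAdditiveReductionAt_ringOfIntegers`). -/
theorem hasAdditiveReductionAt_of_addv (h : Addv W p) :
    W.HasAdditiveReductionAt ((primesEquiv (R := 𝓞 ℚ)).symm ⟨p, hp.out⟩) := by
  set v : HeightOneSpectrum (𝓞 ℚ) := (primesEquiv (R := 𝓞 ℚ)).symm ⟨p, hp.out⟩ with hvdef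
  have hv : (primesEquiv v : ℕ) = p := primesEquiv_symm_apply_coe p
  have key := W.hasAdditiveReduction_padic_iff_hasAdditiveReductionAt_ringOfIntegers v
  revert key
  generalize primesEquiv v = q at hv ⊢
  obtain ⟨q, hq⟩ := q
  cases hv
  intro key
  exact key.mp
    (((hasGoodReduction_or_hasMultiplicativeReduction_or_hasAdditiveReduction _).resolve_left
      h.1).resolve_left h.2)

variable (F : Type) [Field F] [NumberField F] [IsGalois ℚ F]

/-- **Over `ℚ`: an additive prime of `E` stays additive for `E_F` at every place of a finite Galois
`F/ℚ` above `p`, as soon as `p` is unramified in `F`** — in particular for every totally real `F`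
admitted by the printed Iwasawa main conjectures over `F` (Wan 2015 §1.1: "`p` unramified in `F`";
BCS 2025 (ur): `p ∤ D_F`). -/
theorem hasAdditiveReductionAt_baseChange_of_addv_of_unramified (h : Addv W p)
    {w : HeightOneSpectrum (𝓞 F)} (hw : w.asIdeal.under (𝓞 ℚ) = ((primesEquiv (R := 𝓞 ℚ)).symm ⟨p, hp.out⟩).asIdeal)
    (he : ((primesEquiv (R := 𝓞 ℚ)).symm ⟨p, hp.out⟩).asIdeal.ramificationIdxIn (𝓞 F) = 1) :
    (W.baseChange F).HasAdditiveReductionAt w :=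
  hasAdditiveReductionAt_baseChange_of_ramificationIdxIn_eq_one W F hw he
    (hasAdditiveReductionAt_of_addv W p h)

/-- **The located gap, over `ℚ`**: if `E` is additive at `p` (`Addv W p`) and `E_F` is semistable at
some place `w` of a finite Galois `F/ℚ` above `p`, then `p` ramifies in `F` (`e(p) ≠ 1`). So no
field with `p` unramified — the standing hypothesis of every printed `p`-part input over `F ≠ ℚ` —
can serve the base-change-and-descend route for the additive classes X3/X4. -/
theorem ramificationIdxIn_ne_one_of_addv_of_isSemistableAt_baseChange (h : Addv W p)
    {w : HeightOneSpectrum (𝓞 F)} (hw : w.asIdeal.under (𝓞 ℚ) = ((primesEquiv (R := 𝓞 ℚ)).symm ⟨p, hp.out⟩).asIdeal)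
    (hss : (W.baseChange F).IsSemistableAt w) :
    ((primesEquiv (R := 𝓞 ℚ)).symm ⟨p, hp.out⟩).asIdeal.ramificationIdxIn (𝓞 F) ≠ 1 :=
  ramificationIdxIn_ne_one_of_isSemistableAt_baseChange W F hw
    (hasAdditiveReductionAt_of_addv W p h) hss

end Rat

end Summit.BirchSwinnertonDyer.Rank1Residual.Additive

end
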